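import Mathlib
import Literature.MathematicalPhysics.StatisticalMechanics.LocalMatchingCompactness

/-!
# Rootedness and the gapped-twelve clause pass to local limits

Helper for the crux `GappedShellCensus.CleanLimitsHaveWindows` (stmt-AtomisticToContinuum-15932), line
`Sketch`, stub `stub_gappedLimitClosed` (pure metric geometry, no energy).

A set `Y ⊆ ℝ³` is *gapped-twelve at scale `a` at the site `y ∈ Y`* if exactly `12` other points of `Y` lie
within `a(1 + 1/50)` of `y`, no other point is closer than `a(1 - 1/50)`, and no point lies in the open
annulus `a(1 + 1/50) < dist y · < 63a/50`. Let `Z_k ∋ 0` be gapped-twelve at every site and let `Z_k → Z`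
locally, i.e. for every radius `R` and every `ε > 0`, eventually in `k`, `Z_k` and `Z` are two-way
`ε`-matched on the closed ball of radius `R` about `0` (`BallMatch ε R 0 (Z_k) Z`), where `Z` is
`a(1 - 1/50)`-separated. Then `0 ∈ Z` and `Z` is gapped-twelve at every site:

* `0 ∈ Z`: points of `Z` arbitrarily close to `0` exist (match the origin of `Z_k`); by separation they are
  all one point, which is then `0`.
* the bands: two distinct points `y, w ∈ Z` are eventually matched by distinct `y', w' ∈ Z_k` with
  `|dist y' w' - dist y w| ≤ 2ε`; the forbidden annulus is open, so it stays forbidden in the limit.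
* the count: for `ε = a/100` and `k` large the matching restricts to injections between the shell of `y`
  in `Z` and the shell of its partner `y'` in `Z_k` (both ways), because `a(1 + 1/50) + 2ε < 63a/50` and
  `2ε < a(1 - 1/50)`.
-/

noncomputable section

namespace Summit.AtomisticToContinuum.Crystallization.Theorems.CleanHull

open Filter Metric
open Literature.MathematicalPhysics.StatisticalMechanics

/-- **Rootedness passes to the limit.** If `0 ∈ Z_k` for all `k`, `Z` is `a(1 - 1/50)`-separated
(`a > 0`) and `Z_k → Z` locally, then `0 ∈ Z`. [folklore] -/
theorem gappedLimit_zero_mem {a : ℝ} (ha : 0 < a) {Zs : ℕ → Set (EuclideanSpace ℝ (Fin 3))}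
    {Z : Set (EuclideanSpace ℝ (Fin 3))}
    (h0 : ∀ k, (0 : EuclideanSpace ℝ (Fin 3)) ∈ Zs k)
    (hsep : ∀ p ∈ Z, ∀ q ∈ Z, p ≠ q → a * (1 - 1 / 50) ≤ dist p q)
    (hlim : ∀ R ε : ℝ, 0 < ε → ∀ᶠ k in Filter.atTop, BallMatch ε R 0 (Zs k) Z) :
    (0 : EuclideanSpace ℝ (Fin 3)) ∈ Z := by
  -- for every `ε > 0` there is a point of `Z` within `ε` of the origin
  have hnear : ∀ ε : ℝ, 0 < ε → ∃ s ∈ Z, dist 0 s ≤ ε := by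
    intro ε hε
    obtain ⟨k, hk⟩ := (hlim 0 ε hε).exists
    exact hk.2 0 (h0 k) (by rw [dist_self])
  obtain ⟨s, hs, hs0⟩ := hnear (a * (1 - 1 / 50) / 4) (by positivity)
  -- by separation, all these points coincide with `s`
  have hsmall : ∀ ε : ℝ, 0 < ε → dist 0 s ≤ ε := by
    intro ε hε
    obtain ⟨s', hs', hs'0⟩ := hnear (min ε (a * (1 - 1 / 50) / 4)) (lt_min hε (by positivity))
    by_cases hss' : s = s'
    · subst hss'
      exact hs'0.trans (min_le_left _ _)
    · have h1 := hsep s hs s' hs' hss'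
      have h2 : dist s s' ≤ a * (1 - 1 / 50) / 4 + a * (1 - 1 / 50) / 4 :=
        calc dist s s' ≤ dist 0 s + dist 0 s' := dist_triangle_left _ _ _
          _ ≤ a * (1 - 1 / 50) / 4 + min ε (a * (1 - 1 / 50) / 4) := add_le_add hs0 hs'0
          _ ≤ a * (1 - 1 / 50) / 4 + a * (1 - 1 / 50) / 4 := by
            gcongr
            exact min_le_right _ _
      exfalso
      linarith
  have hle : dist 0 s ≤ 0 :=
    le_of_forall_pos_le_add fun ε hε => by
      rw [zero_add]
      exact hsmall ε hε
  rw [dist_le_zero.1 hle]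
  exact hs

/-- **The bands pass to the limit.** If every `Z_k` has, at every site, no other point closer than
`a(1 - 1/50)` and none in the open annulus `(a(1 + 1/50), 63a/50)`, `Z` is `a(1 - 1/50)`-separated and
`Z_k → Z` locally, then `Z` has the same bands at every site. [folklore] -/
theorem gappedLimit_bands {a : ℝ} (ha : 0 < a) {Zs : ℕ → Set (EuclideanSpace ℝ (Fin 3))}
    {Z : Set (EuclideanSpace ℝ (Fin 3))}
    (hZs : ∀ k, ∀ y ∈ Zs k, ∀ w ∈ Zs k, w ≠ y → a * (1 - 1 / 50) ≤ dist y w ∧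
      (dist y w ≤ a * (1 + 1 / 50) ∨ a * (63 / 50) ≤ dist y w))
    (hsep : ∀ p ∈ Z, ∀ q ∈ Z, p ≠ q → a * (1 - 1 / 50) ≤ dist p q)
    (hlim : ∀ R ε : ℝ, 0 < ε → ∀ᶠ k in Filter.atTop, BallMatch ε R 0 (Zs k) Z)
    {y : EuclideanSpace ℝ (Fin 3)} (hy : y ∈ Z) {w : EuclideanSpace ℝ (Fin 3)} (hw : w ∈ Z)
    (hwy : w ≠ y) :
    a * (1 - 1 / 50) ≤ dist y w ∧ (dist y w ≤ a * (1 + 1 / 50) ∨ a * (63 / 50) ≤ dist y w) := by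
  refine ⟨hsep y hy w hw (Ne.symm hwy), ?_⟩
  by_contra hcon
  push Not at hcon
  obtain ⟨h1, h2⟩ := hcon
  -- `ε` small against the distances to the two edges of the open annulus
  set ε : ℝ := min ((dist y w - a * (1 + 1 / 50)) / 4) ((a * (63 / 50) - dist y w) / 4) with hε
  have hε0 : 0 < ε := lt_min (by linarith) (by linarith)
  have hε1 : ε ≤ (dist y w - a * (1 + 1 / 50)) / 4 := min_le_left _ _
  have hε2 : ε ≤ (a * (63 / 50) - dist y w) / 4 := min_le_right _ _
  obtain ⟨k, hk⟩ := (hlim (max ‖y‖ ‖w‖) ε hε0).exists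
  obtain ⟨y', hy', hy'y⟩ := hk.1 y hy (by rw [dist_zero_right]; exact le_max_left _ _)
  obtain ⟨w', hw', hw'w⟩ := hk.1 w hw (by rw [dist_zero_right]; exact le_max_right _ _)
  have hup : dist y' w' ≤ dist y w + 2 * ε :=
    calc dist y' w' ≤ dist y' y + dist y w + dist w w' := dist_triangle4 _ _ _ _
      _ ≤ ε + dist y w + ε := by rw [dist_comm w w']; gcongr
      _ = dist y w + 2 * ε := by ring
  have hlo : dist y w ≤ dist y' w' + 2 * ε :=
    calc dist y w ≤ dist y y' + dist y' w' + dist w' w := dist_triangle4 _ _ _ _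
      _ ≤ ε + dist y' w' + ε := by rw [dist_comm y y']; gcongr
      _ = dist y' w' + 2 * ε := by ring
  have hne : w' ≠ y' := by
    rintro rfl
    rw [dist_self] at hlo
    have : 0 < a * (1 + 1 / 50) := by positivity
    linarith
  rcases (hZs k y' hy' w' hw' hne).2 with h | h
  · linarith
  · linarith

/-- The norm of a point is at most its distance from a centre plus the norm of the centre (the form of
the triangle inequality used to certify membership in the matching ball). [folklore] -/
theorem gappedLimit_dist_zero_le (p q : EuclideanSpace ℝ (Fin 3)) : dist p 0 ≤ dist q p + ‖q‖ :=
  calc dist p 0 ≤ dist p q + dist q 0 := dist_triangle _ _ _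
    _ = dist q p + ‖q‖ := by rw [dist_comm, dist_zero_right]

/-- **The count passes to the limit.** If every `Z_k` is gapped-twelve at every site, `Z` is
`a(1 - 1/50)`-separated with no point of `Z` in the open annulus `(a(1 + 1/50), 63a/50)` about any other,
and `Z_k → Z` locally, then every site of `Z` has exactly `12` other points of `Z` within `a(1 + 1/50)`:
for `ε = a/100` and `k` large, the `ε`-matching restricts to injections between the shell of `y` in `Z`
and the shell of its partner `y'` in `Z_k`, both ways. [folklore] -/
theorem gappedLimit_ncard {a : ℝ} (ha : 0 < a) {Zs : ℕ → Set (EuclideanSpace ℝ (Fin 3))}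
    {Z : Set (EuclideanSpace ℝ (Fin 3))}
    (hZs : ∀ k, ∀ y ∈ Zs k, {w ∈ Zs k | w ≠ y ∧ dist y w ≤ a * (1 + 1 / 50)}.ncard = 12 ∧
        ∀ w ∈ Zs k, w ≠ y → a * (1 - 1 / 50) ≤ dist y w ∧
          (dist y w ≤ a * (1 + 1 / 50) ∨ a * (63 / 50) ≤ dist y w))
    (hsep : ∀ p ∈ Z, ∀ q ∈ Z, p ≠ q → a * (1 - 1 / 50) ≤ dist p q)
    (hgapZ : ∀ y ∈ Z, ∀ w ∈ Z, w ≠ y → dist y w ≤ a * (1 + 1 / 50) ∨ a * (63 / 50) ≤ dist y w)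
    (hlim : ∀ R ε : ℝ, 0 < ε → ∀ᶠ k in Filter.atTop, BallMatch ε R 0 (Zs k) Z)
    {y : EuclideanSpace ℝ (Fin 3)} (hy : y ∈ Z) :
    {w ∈ Z | w ≠ y ∧ dist y w ≤ a * (1 + 1 / 50)}.ncard = 12 := by
  have hε0 : 0 < a / 100 := by positivity
  obtain ⟨k, hk⟩ := (hlim (‖y‖ + 2 * a) (a / 100) hε0).exists
  -- the partner `y'` of `y` in `Z_k`
  obtain ⟨y', hy', hy'y⟩ := hk.1 y hy (by rw [dist_zero_right]; linarith)
  obtain ⟨hcard', hband'⟩ := hZs k y' hy'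
  -- the two shells
  set S : Set (EuclideanSpace ℝ (Fin 3)) := {w ∈ Z | w ≠ y ∧ dist y w ≤ a * (1 + 1 / 50)} with hS
  set S' : Set (EuclideanSpace ℝ (Fin 3)) :=
    {w ∈ Zs k | w ≠ y' ∧ dist y' w ≤ a * (1 + 1 / 50)} with hS'
  have hS'fin : S'.Finite := Set.finite_of_ncard_pos (by rw [hcard']; norm_num)
  have hSfin : S.Finite :=
    finite_of_forall_le_dist_of_subset_closedBall (δ := a * (1 - 1 / 50)) (by positivity)
      (fun p hp q hq hpq => hsep p hp.1 q hq.1 hpq) (c := y) (R := a * (1 + 1 / 50))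
      fun w hw => by
        rw [mem_closedBall, dist_comm]
        exact hw.2.2
  -- (≤) match the shell of `y` in `Z` into the shell of `y'` in `Z_k`
  have hmatch : ∀ w ∈ S, ∃ w' ∈ Zs k, dist w' w ≤ a / 100 := fun w hw =>
    hk.1 w hw.1 (by linarith [gappedLimit_dist_zero_le w y, hw.2.2])
  choose! f hfZ hfd using hmatch
  have hfS' : ∀ w ∈ S, f w ∈ S' := by
    intro w hw
    have hwy : a * (1 - 1 / 50) ≤ dist y w := hsep y hy w hw.1 (Ne.symm hw.2.1)
    have hlo : dist y w ≤ dist y' (f w) + 2 * (a / 100) :=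
      calc dist y w ≤ dist y y' + dist y' (f w) + dist (f w) w := dist_triangle4 _ _ _ _
        _ ≤ a / 100 + dist y' (f w) + a / 100 := by rw [dist_comm y y']; gcongr; exact hfd w hw
        _ = dist y' (f w) + 2 * (a / 100) := by ring
    have hup : dist y' (f w) ≤ dist y w + 2 * (a / 100) :=
      calc dist y' (f w) ≤ dist y' y + dist y w + dist w (f w) := dist_triangle4 _ _ _ _
        _ ≤ a / 100 + dist y w + a / 100 := by rw [dist_comm w (f w)]; gcongr; exact hfd w hw
        _ = dist y w + 2 * (a / 100) := by ring
    have hne : f w ≠ y' := by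
      rintro h
      rw [h, dist_self] at hlo
      linarith
    refine ⟨hfZ w hw, hne, ?_⟩
    rcases (hband' (f w) (hfZ w hw) hne).2 with h | h
    · exact h
    · exfalso
      linarith [hw.2.2]
  have hfinj : Set.InjOn f S := by
    intro w₁ hw₁ w₂ hw₂ h
    by_contra hne
    have h1 := hsep w₁ hw₁.1 w₂ hw₂.1 hne
    have h2 : dist w₁ w₂ ≤ a / 100 + a / 100 :=
      calc dist w₁ w₂ ≤ dist (f w₁) w₁ + dist (f w₁) w₂ := dist_triangle_left _ _ _
        _ ≤ a / 100 + a / 100 := by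
          gcongr
          · exact hfd w₁ hw₁
          · rw [h]; exact hfd w₂ hw₂
    linarith
  have hle : S.ncard ≤ S'.ncard := Set.ncard_le_ncard_of_injOn f hfS' hfinj hS'fin
  -- (≥) match the shell of `y'` in `Z_k` into the shell of `y` in `Z`
  have hy'norm : ‖y'‖ ≤ a / 100 + ‖y‖ := by
    rw [← dist_zero_right]
    exact gappedLimit_dist_zero_le y' y |>.trans (by rw [dist_comm]; gcongr)
  have hmatch' : ∀ w' ∈ S', ∃ w ∈ Z, dist w' w ≤ a / 100 := fun w' hw' =>
    hk.2 w' hw'.1 (by nlinarith [gappedLimit_dist_zero_le w' y', hw'.2.2])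
  choose! g hgZ hgd using hmatch'
  have hgS : ∀ w' ∈ S', g w' ∈ S := by
    intro w' hw'
    have hwy : a * (1 - 1 / 50) ≤ dist y' w' := (hband' w' hw'.1 hw'.2.1).1
    have hlo : dist y' w' ≤ dist y (g w') + 2 * (a / 100) :=
      calc dist y' w' ≤ dist y' y + dist y (g w') + dist (g w') w' := dist_triangle4 _ _ _ _
        _ ≤ a / 100 + dist y (g w') + a / 100 := by rw [dist_comm (g w') w']; gcongr; exact hgd w' hw'
        _ = dist y (g w') + 2 * (a / 100) := by ring
    have hup : dist y (g w') ≤ dist y' w' + 2 * (a / 100) :=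
      calc dist y (g w') ≤ dist y y' + dist y' w' + dist w' (g w') := dist_triangle4 _ _ _ _
        _ ≤ a / 100 + dist y' w' + a / 100 := by rw [dist_comm y y']; gcongr; exact hgd w' hw'
        _ = dist y' w' + 2 * (a / 100) := by ring
    have hne : g w' ≠ y := by
      rintro h
      rw [h, dist_self] at hlo
      linarith
    refine ⟨hgZ w' hw', hne, ?_⟩
    rcases hgapZ y hy (g w') (hgZ w' hw') hne with h | h
    · exact h
    · exfalso
      linarith [hw'.2.2]
  have hginj : Set.InjOn g S' := by
    intro w₁ hw₁ w₂ hw₂ h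
    by_contra hne
    have h1 := ((hZs k w₁ hw₁.1).2 w₂ hw₂.1 (Ne.symm hne)).1
    have h2 : dist w₁ w₂ ≤ a / 100 + a / 100 :=
      calc dist w₁ w₂ ≤ dist w₁ (g w₁) + dist w₂ (g w₁) := dist_triangle_right _ _ _
        _ ≤ a / 100 + a / 100 := by
          gcongr
          · exact hgd w₁ hw₁
          · rw [h]; exact hgd w₂ hw₂
    linarith
  have hge : S'.ncard ≤ S.ncard := Set.ncard_le_ncard_of_injOn g hgS hginj hSfin
  omega

/-- **Stub S1a (rootedness and the gapped-twelve clause pass to local limits).** Let `Z_k ∋ 0` be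
gapped-twelve at scale `a > 0` at every site, and let `Z_k → Z` locally (two-way `ε`-matched on every ball,
eventually), where `Z` is `a(1 - 1/50)`-separated. Then `0 ∈ Z` and `Z` is gapped-twelve at scale `a` at every
site (closed bands, open forbidden annulus, counts kept by separation). [folklore] -/
theorem stub_gappedLimitClosed (a : ℝ) (ha : 0 < a) (Zs : ℕ → Set (EuclideanSpace ℝ (Fin 3)))
    (Z : Set (EuclideanSpace ℝ (Fin 3)))
    (hZs : ∀ k, ∀ y ∈ Zs k, {w ∈ Zs k | w ≠ y ∧ dist y w ≤ a * (1 + 1 / 50)}.ncard = 12 ∧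
        ∀ w ∈ Zs k, w ≠ y → a * (1 - 1 / 50) ≤ dist y w ∧
          (dist y w ≤ a * (1 + 1 / 50) ∨ a * (63 / 50) ≤ dist y w))
    (h0 : ∀ k, (0 : EuclideanSpace ℝ (Fin 3)) ∈ Zs k)
    (hsep : ∀ p ∈ Z, ∀ q ∈ Z, p ≠ q → a * (1 - 1 / 50) ≤ dist p q)
    (hlim : ∀ R ε : ℝ, 0 < ε → ∀ᶠ k in Filter.atTop, BallMatch ε R 0 (Zs k) Z) :
    (0 : EuclideanSpace ℝ (Fin 3)) ∈ Z ∧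
      ∀ y ∈ Z, {w ∈ Z | w ≠ y ∧ dist y w ≤ a * (1 + 1 / 50)}.ncard = 12 ∧
        ∀ w ∈ Z, w ≠ y → a * (1 - 1 / 50) ≤ dist y w ∧
          (dist y w ≤ a * (1 + 1 / 50) ∨ a * (63 / 50) ≤ dist y w) := by
  have hbands : ∀ y ∈ Z, ∀ w ∈ Z, w ≠ y → a * (1 - 1 / 50) ≤ dist y w ∧
      (dist y w ≤ a * (1 + 1 / 50) ∨ a * (63 / 50) ≤ dist y w) := fun y hy w hw hwy =>
    gappedLimit_bands ha (fun k y hy => (hZs k y hy).2) hsep hlim hy hw hwy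
  exact ⟨gappedLimit_zero_mem ha h0 hsep hlim, fun y hy =>
    ⟨gappedLimit_ncard ha hZs hsep (fun y hy w hw hwy => (hbands y hy w hw hwy).2) hlim hy,
      hbands y hy⟩⟩

end Summit.AtomisticToContinuum.Crystallization.Theorems.CleanHull

end
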